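import Mathlib.FieldTheory.Extension
import Mathlib.FieldTheory.IsAlgClosed.AlgebraicClosure
import Mathlib.RingTheory.LaurentSeries
import Mathlib.Algebra.MvPolynomial.Equiv
import Mathlib.RingTheory.MvPolynomial.Tower
import Mathlib.Analysis.Complex.Polynomial.Basic
import Literature.FieldTheory.AlgClosed.NewtonPuiseuxProofs
import Literature.Barriers.ValiantsHypothesis.NumericToSymbolicProp33

/-!
# ValiantsHypothesis / BinomialElusive — the local–global link for crux `BinomialMapsElusive`

Support file for `stmt-ValiantsHypothesis-7393` (`BinomialMapsElusive`).

`numericToPuiseux_proof` (Theorems/BinomialElusiveNumericToPuiseux.lean) turns containment of the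
binomial curve in `Γ(ℂ^s)` into ONE formal solution `p ∈ ℂ((t))^s`, `Γ(p) = (t^{N a_i} + t^{N b_i})_i`,
through the relation transfer `exists_laurent_relation_transfer`: every polynomial relation among
`x` and the algebraic functions `b_j(x) ∈ \overline{ℂ(x)}` holds after `x ↦ tᴺ`, `b ↦ p`.

The global analysis of binomial swallowers (STRUCTURE-p2 §1–2 of the crux directory) needs the
CONVERSE as well: an identity found at the place over `0` by an exact local computation (e.g. a
"pure" coordinate `β_i p^{ν_i} = t^{N b_i}`, or a multiplicative relation `p^w = c` among the
branches) is an identity among the algebraic functions themselves, hence holds at every other place.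
This is because the transfer is a FIELD embedding `ℂ(x)(b₁,…,b_s) ↪ ℂ((t))` over `x ↦ tᴺ`
(Newton–Puiseux: `NewtonPuiseux_holds`; Mathlib's `IntermediateField.nonempty_algHom_adjoin_of_splits`),
and field homomorphisms are injective.  We record the transfer as an EQUIVALENCE
(`exists_laurent_embedding`) and package it for the crux (`exists_global_local_solution`):
containment gives algebraic functions `b` with `Γ(b) = f(x)` in `\overline{ℂ(x)}` (GMOW 2019
Prop. 3.3, `GMOW2019_prop33_holds`) together with Laurent series `p` such that, for every
polynomial `G(x, y)`, `G(x, b) = 0 ↔ G(tᴺ, p) = 0`.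
-/

namespace Summit.ValiantsHypothesis.Theorems

open Polynomial
open HahnSeries (single ofPowerSeries)
open Literature.Barriers.ResolutionOfSingularities (ramify ramify_single)

variable {k : Type} [Field k]

/-- The embedding `k[x] ↪ k((t))`, `x ↦ t` (variables indexed by `Fin 1`); route-independent copy of
the lemma in Theorems/BinomialElusiveNumericToPuiseux.lean (that module imports the route file). [folklore] -/
private theorem exists_injective_ringHom_mvPolynomial_laurentSeries' :
    ∃ g : (MvPolynomial (Fin 1) k) →+* LaurentSeries k, Function.Injective g ∧
      (∀ v, g (MvPolynomial.X v) = single (1 : ℤ) 1) ∧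
      (∀ c, g (MvPolynomial.C c) = HahnSeries.C c) := by
  let e : (MvPolynomial (Fin 1) k) ≃ₐ[k] k[X] := MvPolynomial.uniqueAlgEquiv k (Fin 1)
  let g₀ : k[X] →+* LaurentSeries k :=
    (ofPowerSeries ℤ k).comp (Polynomial.coeToPowerSeries.ringHom : k[X] →+* PowerSeries k)
  refine ⟨g₀.comp e.toRingEquiv.toRingHom, ?_, fun v => ?_, fun c => ?_⟩
  · exact (HahnSeries.ofPowerSeries_injective.comp (Polynomial.coe_injective k)).comp e.injective
  · show g₀ (e (MvPolynomial.X v)) = single 1 1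
    have : e (MvPolynomial.X v) = Polynomial.X := by
      simp [e, MvPolynomial.uniqueAlgEquiv_apply]
    rw [this]
    simp [g₀]
  · show g₀ (e (MvPolynomial.C c)) = HahnSeries.C c
    have : e (MvPolynomial.C c) = Polynomial.C c := by
      simp [e, MvPolynomial.uniqueAlgEquiv_apply]
    rw [this]
    simp [g₀]

/-- The embedding `k(x) ↪ k((t))`, `x ↦ t`, of `FractionRing (MvPolynomial (Fin 1) k)`
(route-independent copy). [folklore] -/
private theorem exists_ringHom_fractionRing_laurentSeries' :
    ∃ ι : (FractionRing (MvPolynomial (Fin 1) k)) →+* LaurentSeries k,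
      (∀ v, ι (algebraMap (MvPolynomial (Fin 1) k) (FractionRing (MvPolynomial (Fin 1) k))
        (MvPolynomial.X v)) = single (1 : ℤ) 1) ∧
      (∀ c, ι (algebraMap (MvPolynomial (Fin 1) k) (FractionRing (MvPolynomial (Fin 1) k))
        (MvPolynomial.C c)) = HahnSeries.C c) := by
  obtain ⟨g, hg, hX, hC⟩ := exists_injective_ringHom_mvPolynomial_laurentSeries' (k := k)
  refine ⟨IsFractionRing.lift hg, fun v => ?_, fun c => ?_⟩
  · rw [IsFractionRing.lift_algebraMap, hX]
  · rw [IsFractionRing.lift_algebraMap, hC]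

/-- **Puiseux EMBEDDING of finitely many algebraic functions** (Newton–Puiseux, Serre *Local Fields*
IV §2 Prop. 8, via `NewtonPuiseux_holds`): for `b₁, …, b_s ∈ \overline{k(x)}`, `k` algebraically
closed of characteristic zero, there are `N ≥ 1` and Laurent series `p₁, …, p_s ∈ k((t))` such that
a polynomial relation `G(x, b) = 0` over `k` holds if and only if `G(tᴺ, p) = 0`.  (The forward
direction is `exists_laurent_relation_transfer`; the converse is injectivity of the field embedding
`k(x)(b) ↪ k((t))`.) [folklore] -/
theorem exists_laurent_embedding [IsAlgClosed k] [CharZero k] {s : ℕ}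
    (b : Fin s → (AlgebraicClosure (FractionRing (MvPolynomial (Fin 1) k)))) :
    ∃ N : ℕ, 0 < N ∧ ∃ p : Fin s → LaurentSeries k,
      ∀ G : MvPolynomial (Fin 1 ⊕ Fin s) k,
        MvPolynomial.aeval (Sum.elim (fun v => algebraMap (MvPolynomial (Fin 1) k)
          (AlgebraicClosure (FractionRing (MvPolynomial (Fin 1) k))) (MvPolynomial.X v)) b)
            G = 0 ↔
        MvPolynomial.aeval (Sum.elim (fun _ => single (N : ℤ) (1 : k)) p) G = 0 := by
  classical
  obtain ⟨ι, hιX, hιC⟩ := exists_ringHom_fractionRing_laurentSeries' (k := k)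
  -- the minimal polynomials of the `b j`, mapped to `k((x))[T]`, split after a common `x = tᴺ`
  have hint : ∀ j, IsIntegral (FractionRing (MvPolynomial (Fin 1) k)) (b j) :=
    fun j => Algebra.IsIntegral.isIntegral (b j)
  set P : (LaurentSeries k)[X] :=
    ∏ j, (minpoly (FractionRing (MvPolynomial (Fin 1) k)) (b j)).map ι with hP
  obtain ⟨N, hN, hsplit⟩ := Literature.FieldTheory.AlgClosed.NewtonPuiseux_holds k P
  have hP0 : P ≠ 0 := by
    rw [hP]
    exact Finset.prod_ne_zero_iff.mpr fun j _ =>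
      Polynomial.map_ne_zero (minpoly.ne_zero (hint j))
  set ιN : FractionRing (MvPolynomial (Fin 1) k) →+* LaurentSeries k :=
    (ramify k N hN).comp ι with hιN
  letI : Algebra (FractionRing (MvPolynomial (Fin 1) k)) (LaurentSeries k) := ιN.toAlgebra
  have halg : (algebraMap (FractionRing (MvPolynomial (Fin 1) k)) (LaurentSeries k) :
      FractionRing (MvPolynomial (Fin 1) k) →+* LaurentSeries k) = ιN := rfl
  have hK : ∀ x ∈ Set.range b, IsIntegral (FractionRing (MvPolynomial (Fin 1) k)) x ∧
      ((minpoly (FractionRing (MvPolynomial (Fin 1) k)) x).map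
        (algebraMap (FractionRing (MvPolynomial (Fin 1) k)) (LaurentSeries k))).Splits := by
    rintro _ ⟨j, rfl⟩
    refine ⟨hint j, ?_⟩
    rw [halg, hιN, ← Polynomial.map_map]
    refine Polynomial.Splits.of_dvd hsplit
      ((Polynomial.map_ne_zero_iff (ramify k N hN).injective).mpr hP0) ?_
    exact Polynomial.map_dvd _ (Finset.dvd_prod_of_mem _ (Finset.mem_univ j))
  -- hence `k(x)(b₁, …, b_s)` embeds into `k((t))` over `x ↦ tᴺ`
  obtain ⟨ψ⟩ := IntermediateField.nonempty_algHom_adjoin_of_splits hK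
  set E := IntermediateField.adjoin (FractionRing (MvPolynomial (Fin 1) k)) (Set.range b) with hE
  have hbE : ∀ j, b j ∈ E :=
    fun j => IntermediateField.subset_adjoin (FractionRing (MvPolynomial (Fin 1) k)) _ ⟨j, rfl⟩
  set b' : Fin s → E := fun j => ⟨b j, hbE j⟩ with hb'
  refine ⟨N, hN, fun j => ψ (b' j), fun G => ?_⟩
  -- pass to coefficients in `k(x)`
  set G' : MvPolynomial (Fin 1 ⊕ Fin s) (FractionRing (MvPolynomial (Fin 1) k)) :=
    MvPolynomial.map (algebraMap k (FractionRing (MvPolynomial (Fin 1) k))) G with hG'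
  set y : Fin 1 ⊕ Fin s → E :=
    Sum.elim (fun v => algebraMap (FractionRing (MvPolynomial (Fin 1) k)) E
      (algebraMap (MvPolynomial (Fin 1) k) (FractionRing (MvPolynomial (Fin 1) k))
        (MvPolynomial.X v))) b' with hy
  -- (1) the relation in `K̄` is the relation `G'(y) = 0` in `E`
  have hval : (fun i => E.val (y i)) =
      Sum.elim (fun v => algebraMap (MvPolynomial (Fin 1) k)
        (AlgebraicClosure (FractionRing (MvPolynomial (Fin 1) k))) (MvPolynomial.X v)) b := by
    funext i
    rcases i with v | j
    · simp only [hy, Sum.elim_inl, IntermediateField.coe_val,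
        IntermediateField.coe_algebraMap_apply]
      exact (IsScalarTower.algebraMap_apply (MvPolynomial (Fin 1) k)
        (FractionRing (MvPolynomial (Fin 1) k))
        (AlgebraicClosure (FractionRing (MvPolynomial (Fin 1) k))) _).symm
    · rfl
  have h1 : MvPolynomial.aeval (Sum.elim (fun v => algebraMap (MvPolynomial (Fin 1) k)
          (AlgebraicClosure (FractionRing (MvPolynomial (Fin 1) k))) (MvPolynomial.X v)) b)
            G = 0 ↔ MvPolynomial.aeval y G' = 0 := by
    rw [← (E.val).toRingHom.injective.eq_iff, RingHom.map_zero]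
    change _ ↔ E.val _ = 0
    rw [← AlgHom.comp_apply, MvPolynomial.comp_aeval, hval, hG',
      MvPolynomial.aeval_map_algebraMap]
  -- (2) apply the (injective) field homomorphism `ψ`
  have h2 : MvPolynomial.aeval y G' = 0 ↔ MvPolynomial.aeval (fun i => ψ (y i)) G' = 0 := by
    rw [← ψ.toRingHom.injective.eq_iff, RingHom.map_zero]
    change ψ _ = 0 ↔ _
    rw [← AlgHom.comp_apply, MvPolynomial.comp_aeval]
  have hψy : (fun i => ψ (y i)) =
      Sum.elim (fun _ => single (N : ℤ) (1 : k)) (fun j => ψ (b' j)) := by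
    funext i
    rcases i with v | j
    · simp only [hy, Sum.elim_inl, AlgHom.commutes, halg, hιN, RingHom.comp_apply]
      rw [hιX, ramify_single, mul_one]
    · rfl
  rw [hψy] at h2
  -- (3) back to coefficients in `k`
  have hιNk : ιN.comp (algebraMap k (FractionRing (MvPolynomial (Fin 1) k))) =
      algebraMap k (LaurentSeries k) := by
    refine RingHom.ext fun c => ?_
    rw [RingHom.comp_apply, hιN, RingHom.comp_apply,
      IsScalarTower.algebraMap_apply k (MvPolynomial (Fin 1) k)
        (FractionRing (MvPolynomial (Fin 1) k)), MvPolynomial.algebraMap_eq, hιC,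
      HahnSeries.C_apply, ramify_single, mul_zero, ← HahnSeries.C_apply]
    exact (LaurentSeries.algebraMap_apply (K := k) c).symm
  have h3 : MvPolynomial.aeval (R := (FractionRing (MvPolynomial (Fin 1) k)))
      (Sum.elim (fun _ => single (N : ℤ) (1 : k)) (fun j => ψ (b' j))) G' =
      MvPolynomial.aeval (Sum.elim (fun _ => single (N : ℤ) (1 : k)) (fun j => ψ (b' j))) G := by
    rw [MvPolynomial.aeval_def, MvPolynomial.aeval_def, hG', MvPolynomial.eval₂_map, halg, hιNk]
  rw [h3] at h2
  exact h1.trans h2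

/-- **Global and local solution together** (packaging for crux `BinomialMapsElusive`): if the
binomial curve `x ↦ (x^{a_i} + x^{b_i})_i` lies in `Γ(ℂ^s)`, there are algebraic functions
`z ∈ \overline{ℂ(x)}^s` with `Γ(z) = (x^{a_i} + x^{b_i})_i` in `\overline{ℂ(x)}` (GMOW 2019 Prop. 3.3)
and, for some `N ≥ 1`, Laurent series `p ∈ ℂ((t))^s` with `Γ(p) = (t^{N a_i} + t^{N b_i})_i` such
that `z` and `p` satisfy exactly the same polynomial relations with `x` resp. `tᴺ`:
`G(x, z) = 0 ↔ G(tᴺ, p) = 0`.  So identities among the branches `p_j` at the place over `0` are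
identities among the algebraic functions `z_j`. [folklore] -/
theorem exists_global_local_solution {m s : ℕ} (a b : Fin m → ℕ)
    (Γ : Fin m → MvPolynomial (Fin s) ℂ)
    (hsub : Set.range (fun x : ℂ => fun i : Fin m => x ^ a i + x ^ b i) ⊆
      Set.range (fun y : Fin s → ℂ => fun i : Fin m => MvPolynomial.eval y (Γ i))) :
    ∃ (z : Fin s → AlgebraicClosure (FractionRing (MvPolynomial (Fin 1) ℂ))) (N : ℕ)
      (p : Fin s → LaurentSeries ℂ), 0 < N ∧
      (∀ i, MvPolynomial.aeval z (Γ i) =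
        algebraMap (MvPolynomial (Fin 1) ℂ) (AlgebraicClosure (FractionRing (MvPolynomial (Fin 1) ℂ)))
          (MvPolynomial.X 0 ^ a i + MvPolynomial.X 0 ^ b i)) ∧
      (∀ i, MvPolynomial.aeval p (Γ i) =
        single ((N * a i : ℕ) : ℤ) (1 : ℂ) + single ((N * b i : ℕ) : ℤ) (1 : ℂ)) ∧
      (∀ G : MvPolynomial (Fin 1 ⊕ Fin s) ℂ,
        MvPolynomial.aeval (Sum.elim (fun v => algebraMap (MvPolynomial (Fin 1) ℂ)
          (AlgebraicClosure (FractionRing (MvPolynomial (Fin 1) ℂ))) (MvPolynomial.X v)) z) G = 0 ↔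
        MvPolynomial.aeval (Sum.elim (fun _ => single (N : ℤ) (1 : ℂ)) p) G = 0) := by
  classical
  -- the curve as a polynomial map `ℂ¹ → ℂ^m`
  set L : Fin m → MvPolynomial (Fin 1) ℂ :=
    fun i => MvPolynomial.X 0 ^ a i + MvPolynomial.X 0 ^ b i with hL
  have hLM : ∀ β : Fin 1 → ℂ, ∃ γ : Fin s → ℂ, ∀ i,
      MvPolynomial.eval β (L i) = MvPolynomial.eval γ (Γ i) := by
    intro β
    obtain ⟨y, hy⟩ := hsub ⟨β 0, rfl⟩
    refine ⟨y, fun i => ?_⟩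
    rw [show MvPolynomial.eval y (Γ i) = β 0 ^ a i + β 0 ^ b i from congr_fun hy i]
    simp [hL]
  obtain ⟨bb, hbb⟩ := Literature.Barriers.ValiantsHypothesis.GMOW2019_prop33_holds ℂ (Fin 1)
    (Fin s) (Fin m) L Γ hLM
  obtain ⟨N, hN, p, hp⟩ := exists_laurent_embedding bb
  refine ⟨bb, N, p, hN, fun i => (hbb i).symm, fun i => ?_, hp⟩
  have key := (hp (MvPolynomial.rename Sum.inl (L i) - MvPolynomial.rename Sum.inr (Γ i))).mp (by
    rw [map_sub, MvPolynomial.aeval_rename, MvPolynomial.aeval_rename, sub_eq_zero,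
      Sum.elim_comp_inl, Sum.elim_comp_inr,
      Literature.Barriers.ValiantsHypothesis.aeval_algebraMap_X_eq]
    exact hbb i)
  rw [map_sub, MvPolynomial.aeval_rename, MvPolynomial.aeval_rename, sub_eq_zero,
    Sum.elim_comp_inl, Sum.elim_comp_inr] at key
  rw [← key]
  simp only [hL, map_add, map_pow, MvPolynomial.aeval_X, HahnSeries.single_pow, one_pow]
  push_cast
  rw [nsmul_eq_mul, nsmul_eq_mul, mul_comm (a i : ℤ), mul_comm (b i : ℤ)]

end Summit.ValiantsHypothesis.Theorems
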